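import Summits.BirchSwinnertonDyer.BirchSwinnertonDyer.Theorems.ManinLocalTwoThreeKummerCubeRootSigmaIdentification
import Summits.BirchSwinnertonDyer.BirchSwinnertonDyer.Theorems.ManinLocalTwoThreeKummerCubeRootSigmaAutomorphy
import Summits.BirchSwinnertonDyer.BirchSwinnertonDyer.Theorems.ManinLocalTwoThreeKummerSquareAnalyticDictionary
import Summits.BirchSwinnertonDyer.BirchSwinnertonDyer.Theorems.ManinLocalTwoThreeSigmaSquareRootLeaves
import HarnessLib

/-!
# The `ℓ = 2` twin: the square root of the Kummer series of a rational `2`-torsion point IS `κ·t_s·V_a(c·E_f)` near `i∞`, with its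
# `Γ₀(N)`-multiplier (route `ManinLocalTwoThree`, crux C2 `ManinOddAtFour` stmt-BirchSwinnertonDyer-22967; cell bsd-f2-manin, p2 gen 17;
`--supports stmt-BirchSwinnertonDyer-22967`)

The `p = 2` counterpart of today's AN2-a/b/c for the UDC line (C3 v23): the ∞-side of a prospective «UDC line at `ℓ = 2`» for C2's reducible
residual (`2 ∣ c` ⟹ E-an-47 `√Ξ_T ∈ Frac ℤ₂⟦q⟧` ⟹ … ⟹ `Γ_T ⊇ Γ₁(N)` ⟹ `c·Λ₁(f) ⊆ Λ_a` — a contradiction wherever `Λ₁(f) = Λ₀(f)`, e.g. the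
LEAD's `periodLatticeGamma1_eq_of_four_mul_prime_pow` levels `N = 4q^e`, `q ≡ 3 (4)`).  PROVED here (no sorry, no definition):

* `exists_analytic_shortT_mul_sigmaSqRoot` — `t_s·V_a(w) = Φ(w)`, `Φ` analytic at `w = 0`, `Φ(0) = σ(−a)/c ≠ 0` (`V_a = sigmaSqRoot`, p2 g16);
* **`exists_hasSum_sqRoot_kummerSeries`** — for ANY formal `h` with `h² = Ξ_T := kummerSeries W c x₀ z`, `h(0) = 1` (`x₀` a rational
  `2`-division root, THE germ `z`, `c ≠ 0`): `∃ R` analytic at `0`, `R(0) = 1`, `B`: `HasSum (hₙ𝕢₁τⁿ) (R(𝕢₁τ))` and `R(𝕢₁τ)² = t_s²(x_s − e_s)`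
  (p2 g16's S1₂ value) for `Im τ > B` (generic `exists_analytic_root_of_formal_root`, k = 2);
* **`exists_hasSum_const_mul_shortT_mul_sigmaSqRoot`** — `Σ hₙ𝕢₁τⁿ = κ·t_s(τ)·V_{a,m₁η₁+m₂η₂}(c·E_f τ)` for `Im τ > B`, with `a ∉ Λ`,
  `2a = m₁ω₁ + m₂ω₂`, `c²℘(a) = e_s` (S6₂) and `κ ≠ 0` (S3₂ `exists_weierstrassP_sub_eq_mul_sigmaSqRoot_sq` + Taylor uniqueness);
* **`exists_sqMultiplier_gamma`**, **`forall_gamma_smul_eq_iff_sigmaSqRoot_periodic`** — `G₂(γτ) = ρ_γ·G₂(τ)` for `G₂ = t_s·V_a(c·E_f)`,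
  `γ ∈ Γ₀(N)`, and `(∀ τ, G₂(γτ) = G₂ τ) ⟺ (∀ w, V_a(w + c{∞,γ∞}_f) = V_a(w))` (the `ℓ = 2` Kummer character; `G₂ ≢ 0`).

HONEST FRAMING.  Kernel helpers for a line nobody has typed yet (proposal to the C2 LEAD on STATUS); the same two inputs as at `ℓ = 3` remain
beyond these: the holomorphic extension across `φ⁻¹(E[2] ∖ O)` (algebraicity of `j` there) and growth at the other cusps; plus BI₂ (from the
tree theorem E-an-47) and minimal-model integrality.  BSD is not proved by this; Manin's conjecture is not proved; C2 `ManinOddAtFour` and C3 OPEN.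
[folklore]
-/

set_option autoImplicit false
-- lint-debt: the directory name repeats the summit name (sibling precedent `ManinLocalTwoThreeSigmaSquareRootLeaves.lean`)
set_option linter.dupNamespace false

noncomputable section

open scoped Topology PeriodPair MatrixGroups
open Complex Filter PowerSeries CongruenceSubgroup
open Literature.NumberTheory.EllipticCurves Literature.NumberTheory.EllipticCurves.ModularForms
open Summit.BirchSwinnertonDyer.Rank1Residual.ManinAdditive.CuspidalKummer
open Summit.BirchSwinnertonDyer.Rank1Residual.ManinAdditive.CuspidalKummerThree
open Summit.BirchSwinnertonDyer.Rank1Residual.ManinAdditive.KummerCubeMonodromy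
open Summit.BirchSwinnertonDyer.BirchSwinnertonDyer.Theorems.ManinLocalTwoThree.KummerCubeAnalytic
open Summit.BirchSwinnertonDyer.BirchSwinnertonDyer.Theorems.ManinLocalTwoThree.SigmaSquareRoot
open Summit.BirchSwinnertonDyer.BirchSwinnertonDyer.Theorems.ManinLocalTwoThree.KummerCubeRootDictionary

namespace Summit.BirchSwinnertonDyer.BirchSwinnertonDyer.Theorems.ManinLocalTwoThree.KummerSquareRootDictionary

variable {W : WeierstrassCurve ℚ} {N : ℕ} [NeZero N]

/-! ### §1 `t_s·V_a` is an analytic germ in `w` at `0` -/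

/-- **`t_s · V_a = Φ(w)` with `Φ` analytic at `w = 0`, `Φ(0) = σ(−a)/c ≠ 0`**: `Φ(w) = −2P₂(w)e^{ew/2}σ(w − a)/(c·P₃(w))`. [folklore] -/
theorem exists_analytic_shortT_mul_sigmaSqRoot [W.IsElliptic] (D : ModularParametrizationData W N) (hc0 : D.c ≠ 0)
    {a : ℂ} (ha : a ∉ D.L.lattice) (e : ℂ) :
    ∃ Φ P₃ : ℂ → ℂ, AnalyticAt ℂ Φ 0 ∧ Φ 0 ≠ 0 ∧ Differentiable ℂ P₃ ∧ P₃ 0 = -2 ∧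
      ∀ τ : UpperHalfPlane, (D.c : ℂ) * eichlerIntegral D.f τ ∉ D.L.lattice → P₃ ((D.c : ℂ) * eichlerIntegral D.f τ) ≠ 0 →
        shortT D τ * sigmaSqRoot D.L a e ((D.c : ℂ) * eichlerIntegral D.f τ) = Φ ((D.c : ℂ) * eichlerIntegral D.f τ) := by
  obtain ⟨P₂, P₃, hP₂, hP₃, hP₂0, hP₃0, hP₂eq, hP₃eq⟩ := exists_entire_weierstrassP_sigma_values D.L
  have hσ : Differentiable ℂ D.L.weierstrassSigma := D.L.differentiable_weierstrassSigma_holds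
  have hc : (D.c : ℂ) ≠ 0 := Int.cast_ne_zero.mpr hc0
  have hσa : D.L.weierstrassSigma (0 - a) ≠ 0 := by
    rw [zero_sub]
    intro h
    exact ha (by simpa using D.L.lattice.neg_mem ((D.L.weierstrassSigma_eq_zero_iff_holds (-a)).mp h))
  refine ⟨fun w => -2 * P₂ w * cexp (e * w / 2) * D.L.weierstrassSigma (w - a) / ((D.c : ℂ) * P₃ w), P₃, ?_, ?_, hP₃, hP₃0, ?_⟩
  · have hnum : AnalyticAt ℂ (fun w => -2 * P₂ w * cexp (e * w / 2) * D.L.weierstrassSigma (w - a)) 0 := by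
      refine ((analyticAt_const.mul (hP₂.analyticAt 0)).mul ?_).mul ?_
      · exact ((analyticAt_const.mul analyticAt_id).div_const).cexp'
      · exact ((hσ.comp (differentiable_id.sub_const a)).analyticAt 0)
    have hden : AnalyticAt ℂ (fun w => (D.c : ℂ) * P₃ w) 0 := analyticAt_const.mul (hP₃.analyticAt 0)
    exact hnum.div hden (by simp [hP₃0, hc])
  · simp only [mul_zero, zero_div, Complex.exp_zero, mul_one, hP₂0, hP₃0]
    exact div_ne_zero (mul_ne_zero (by norm_num) hσa) (mul_ne_zero hc (by norm_num))
  · intro τ hw hP₃w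
    set w : ℂ := (D.c : ℂ) * eichlerIntegral D.f τ with hw_def
    have hσw : D.L.weierstrassSigma w ≠ 0 := fun h => hw ((D.L.weierstrassSigma_eq_zero_iff_holds w).mp h)
    have h℘ : ℘[D.L] w = P₂ w / D.L.weierstrassSigma w ^ 2 := by
      rw [hP₂eq w hw]; field_simp
    have h℘' : ℘'[D.L] w = P₃ w / D.L.weierstrassSigma w ^ 3 := by
      rw [hP₃eq w hw]; field_simp
    rw [shortT, shortX, shortY, sigmaSqRoot, ← hw_def, h℘, h℘']
    field_simp

/-! ### §2 The square-root `q`-dictionary (generic k = 2) -/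

/-- **The square root of the Kummer series is the `q`-expansion of a holomorphic square root of `t_s²(x_s − e_s)` near `i∞`.** [folklore] -/
theorem exists_hasSum_sqRoot_kummerSeries [W.IsElliptic] [W.IsGloballyMinimal]
    (D : ModularParametrizationData W N) (a : ℕ → ℤ) (ha : ∀ n, (a n : ℂ) = cuspCoeff D.f n) (hc0 : D.c ≠ 0)
    (x₀ : ℚ) (z : ℚ⟦X⟧) (hz : IsParamGerm W D.c a z)
    (h : ℚ⟦X⟧) (hh2 : h ^ 2 = kummerSeries W D.c x₀ z) (hh0 : constantCoeff h = 1) :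
    ∃ (R : ℂ → ℂ) (B : ℝ), AnalyticAt ℂ R 0 ∧ R 0 = 1 ∧ ∀ τ : UpperHalfPlane, B < τ.im →
      HasSum (fun n : ℕ => ((coeff n h : ℚ) : ℂ) * Function.Periodic.qParam 1 (τ : ℂ) ^ n)
        (R (Function.Periodic.qParam 1 (τ : ℂ))) ∧
      R (Function.Periodic.qParam 1 (τ : ℂ)) ^ 2 = shortT D τ ^ 2 * (shortX D τ - ((shortRoot W D.c x₀ : ℚ) : ℂ)) ∧
      AnalyticAt ℂ R (Function.Periodic.qParam 1 (τ : ℂ)) := by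
  obtain ⟨B, hB⟩ := kummerSquareAnalyticDictionary W D a ha hc0 x₀ z hz
  set Θc : PowerSeries ℂ := PowerSeries.map (algebraMap ℚ ℂ) (kummerSeries W D.c x₀ z) with hΘc
  set hc : PowerSeries ℂ := PowerSeries.map (algebraMap ℚ ℂ) h with hhc
  have hcoefΘ : ∀ n, coeff n Θc = ((coeff n (kummerSeries W D.c x₀ z) : ℚ) : ℂ) := fun n => by
    rw [hΘc, coeff_map, eq_ratCast]
  have hcoefh : ∀ n, coeff n hc = ((coeff n h : ℚ) : ℂ) := fun n => by rw [hhc, coeff_map, eq_ratCast]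
  have hB' : ∀ τ : UpperHalfPlane, B < τ.im →
      HasSum (fun n : ℕ => coeff n Θc * Function.Periodic.qParam 1 (τ : ℂ) ^ n)
        (shortT D τ ^ 2 * (shortX D τ - ((shortRoot W D.c x₀ : ℚ) : ℂ))) := by
    intro τ hτ
    simpa only [hcoefΘ] using hB τ hτ
  obtain ⟨A, hAan, hTA, B₁, hA⟩ := exists_analyticAt_of_hasSum_qParam hB'
  have hhc2 : hc ^ 2 = taylorAt0 A := by rw [hTA, hhc, ← map_pow, hh2]
  have hhc0 : constantCoeff hc = 1 := by
    rw [hhc, ← coeff_zero_eq_constantCoeff, coeff_map, coeff_zero_eq_constantCoeff, hh0]; simp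
  have hA0 : A 0 ≠ 0 := by
    have h1 : constantCoeff hc ^ 2 = A 0 := by rw [← map_pow, hhc2, constantCoeff_taylorAt0]
    rw [hhc0] at h1
    rw [← h1]; norm_num
  obtain ⟨R, hRan, hR0, hTR, hRk, r, hr, hsum⟩ := exists_analytic_root_of_formal_root hAan hA0 two_ne_zero hhc2
  obtain ⟨ρ, hρ, hRball⟩ := hRan.exists_ball_analyticOnNhd
  have hev : ∀ᶠ q in 𝓝[≠] (0 : ℂ), R q ^ 2 = A q ∧ ‖q‖ < r ∧ q ∈ Metric.ball (0 : ℂ) ρ := by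
    have h1 : ∀ᶠ q in 𝓝 (0 : ℂ), ‖q‖ < r := by
      have : Metric.ball (0 : ℂ) r ∈ 𝓝 (0 : ℂ) := Metric.ball_mem_nhds 0 hr
      filter_upwards [this] with q hq
      rwa [Metric.mem_ball, dist_zero_right] at hq
    have h2 : ∀ᶠ q in 𝓝 (0 : ℂ), q ∈ Metric.ball (0 : ℂ) ρ := Metric.ball_mem_nhds 0 hρ
    exact (((hRk.and h1).and h2).filter_mono nhdsWithin_le_nhds).mono fun q hq => ⟨hq.1.1, hq.1.2, hq.2⟩
  obtain ⟨B₂, hB₂⟩ := exists_im_bound_of_eventually hev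
  refine ⟨R, max B₁ B₂, hRan, by rw [hR0, hhc0], fun τ hτ => ?_⟩
  have h1 : B₁ < τ.im := (le_max_left _ _).trans_lt hτ
  have h2 : B₂ < τ.im := (le_max_right _ _).trans_lt hτ
  obtain ⟨hsq, hqr, hqρ⟩ := hB₂ τ h2
  refine ⟨?_, ?_, hRball _ hqρ⟩
  · have hs := hsum _ hqr
    simpa only [hcoefh] using hs
  · rw [hsq, hA τ h1]

/-! ### §3 The identification with the σ-square root -/

/-- **The square root of the Kummer series is `κ·t_s·V_a(c·E_f)` near `i∞`** (`a` the half-period of the `2`-torsion point, `κ ≠ 0`). [folklore] -/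
theorem exists_hasSum_const_mul_shortT_mul_sigmaSqRoot [W.IsElliptic] [W.IsGloballyMinimal]
    (D : ModularParametrizationData W N) (a : ℕ → ℤ) (ha : ∀ n, (a n : ℂ) = cuspCoeff D.f n) (hc0 : D.c ≠ 0)
    {x₀ : ℚ} (hx : W.twoTorsionPolynomial.toPoly.IsRoot x₀) (z : ℚ⟦X⟧) (hz : IsParamGerm W D.c a z)
    (h : ℚ⟦X⟧) (hh2 : h ^ 2 = kummerSeries W D.c x₀ z) (hh0 : constantCoeff h = 1) :
    ∃ (p : ℂ) (m₁ m₂ : ℤ) (κ : ℂ) (B : ℝ), p ∉ D.L.lattice ∧ 2 * p = m₁ * D.L.ω₁ + m₂ * D.L.ω₂ ∧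
      ((shortRoot W D.c x₀ : ℚ) : ℂ) = (D.c : ℂ) ^ 2 * ℘[D.L] p ∧ κ ≠ 0 ∧
      ∀ τ : UpperHalfPlane, B < τ.im →
        HasSum (fun n : ℕ => ((coeff n h : ℚ) : ℂ) * Function.Periodic.qParam 1 (τ : ℂ) ^ n)
          (κ * (shortT D τ * sigmaSqRoot D.L p (m₁ * D.L.η₁ + m₂ * D.L.η₂) ((D.c : ℂ) * eichlerIntegral D.f τ))) := by
  -- S6₂: the half-period `p`
  obtain ⟨p, hpΛ, h2p, h℘p⟩ := exists_halfPeriod_of_twoTorsion_root D hx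
  have hX : ((shortRoot W D.c x₀ : ℚ) : ℂ) = (D.c : ℂ) ^ 2 * ℘[D.L] p := shortRoot_eq_of_weierstrassP_eq W D.c h℘p
  obtain ⟨m₁, m₂, hm⟩ := PeriodPair.mem_lattice.mp h2p
  have hc : (D.c : ℂ) ≠ 0 := Int.cast_ne_zero.mpr hc0
  set e : ℂ := m₁ * D.L.η₁ + m₂ * D.L.η₂ with he
  -- S3₂
  obtain ⟨C, hC0, hS3⟩ := exists_weierstrassP_sub_eq_mul_sigmaSqRoot_sq D.L hpΛ hm.symm
  -- prelims: `t_s·V = Φ(w)`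
  obtain ⟨Φ, P₃, hΦan, hΦ0, hP₃d, hP₃0, hΦeq⟩ := exists_analytic_shortT_mul_sigmaSqRoot D hc0 hpΛ e
  -- §2: the holomorphic square root `R`
  obtain ⟨R, B₁, hRan, hR0, hR⟩ := exists_hasSum_sqRoot_kummerSeries D a ha hc0 x₀ z hz h hh2 hh0
  -- `q → 0`
  have hf1 : cuspCoeff D.f 1 = 1 := by
    rw [D.isNewformOf.2 1, W.isMultiplicative_LFunction.map_one]; simp
  have hev := eventually_smul_qGerm_notMem D.f hf1 D.L hc hP₃d.continuous.continuousAt (by rw [hP₃0]; norm_num)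
  obtain ⟨B₂, hB₂⟩ := exists_im_bound_of_eventually hev
  -- the square identity high in the strip: `R(q)² = K·Φ(w)²`, `K = c²C`
  set K : ℂ := (D.c : ℂ) ^ 2 * C with hK
  set Ψ : ℂ → ℂ := fun q => Φ ((D.c : ℂ) * qGerm D.f q) with hΨ
  have hΨan : AnalyticAt ℂ Ψ 0 := by
    have hinner : AnalyticAt ℂ (fun q : ℂ => (D.c : ℂ) * qGerm D.f q) 0 :=
      analyticAt_const.mul (analyticAt_qGerm D.f)
    have h0 : (fun q : ℂ => (D.c : ℂ) * qGerm D.f q) 0 = 0 := by simp [qGerm_zero]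
    have hcomp : AnalyticAt ℂ (Φ ∘ fun q : ℂ => (D.c : ℂ) * qGerm D.f q) 0 := hΦan.comp_of_eq hinner h0
    rw [hΨ]
    exact hcomp
  have hΨ0 : Ψ 0 = Φ 0 := by simp [hΨ, qGerm_zero]
  have hΨτ : ∀ τ : UpperHalfPlane, Ψ (Function.Periodic.qParam 1 (τ : ℂ)) = Φ ((D.c : ℂ) * eichlerIntegral D.f τ) := by
    intro τ; simp [hΨ, qGerm_apply]
  have hsqid : ∀ τ : UpperHalfPlane, max B₁ B₂ < τ.im →
      R (Function.Periodic.qParam 1 (τ : ℂ)) ^ 2 = K * Ψ (Function.Periodic.qParam 1 (τ : ℂ)) ^ 2 := by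
    intro τ hτ
    have h1 : B₁ < τ.im := (le_max_left _ _).trans_lt hτ
    have h2 : B₂ < τ.im := (le_max_right _ _).trans_lt hτ
    obtain ⟨hwΛ, hP₃w⟩ := hB₂ τ h2
    rw [qGerm_apply] at hwΛ hP₃w
    rw [(hR τ h1).2.1, hX, shortX, ← mul_sub, hS3 _ hwΛ, hΨτ, ← hΦeq τ hwΛ hP₃w, hK]
    ring
  have hev2 : ∀ᶠ q in 𝓝[≠] (0 : ℂ), R q ^ 2 = K * Ψ q ^ 2 := eventually_nhdsWithin_of_forall_im_gt hsqid
  have h0 : R 0 ^ 2 = K * Ψ 0 ^ 2 :=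
    eq_at_zero_of_eventuallyEq (F := fun q => R q ^ 2) (G := fun q => K * Ψ q ^ 2)
      (hRan.continuousAt.pow 2) (continuousAt_const.mul (hΨan.continuousAt.pow 2)) hev2
  have hfull : ∀ᶠ q in 𝓝 (0 : ℂ), R q ^ 2 = K * Ψ q ^ 2 := by
    have h' := eventually_nhdsWithin_iff.mp hev2
    filter_upwards [h'] with q hq
    by_cases hq0 : q = 0
    · subst hq0; exact h0
    · exact hq hq0
  have hΨ0ne : Ψ 0 ≠ 0 := by rw [hΨ0]; exact hΦ0
  set κ : ℂ := R 0 / Ψ 0 with hκdef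
  have hκ0 : κ ≠ 0 := div_ne_zero (by rw [hR0]; norm_num) hΨ0ne
  have hκ2 : κ ^ 2 = K := by
    rw [hκdef, div_pow, div_eq_iff (pow_ne_zero 2 hΨ0ne)]
    exact h0
  have hGan : AnalyticAt ℂ (fun q => κ * Ψ q) 0 := analyticAt_const.mul hΨan
  have hT : taylorAt0 (fun q => κ * Ψ q) = taylorAt0 R := by
    have hpow : taylorAt0 (fun q => κ * Ψ q) ^ 2 = taylorAt0 R ^ 2 := by
      rw [← taylorAt0_pow hGan 2, ← taylorAt0_pow hRan 2]
      apply taylorAt0_congr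
      filter_upwards [hfull] with q hq
      rw [mul_pow, hκ2, hq]
    have hcc : constantCoeff (taylorAt0 (fun q => κ * Ψ q)) = constantCoeff (taylorAt0 R) := by
      rw [constantCoeff_taylorAt0, constantCoeff_taylorAt0, hκdef, div_mul_cancel₀ _ hΨ0ne]
    refine eq_of_pow_eq_of_constantCoeff_eq two_ne_zero hpow hcc ?_
    rw [hcc, constantCoeff_taylorAt0, hR0]; norm_num
  have heq := eventuallyEq_of_taylorAt0_eq hGan hRan hT
  obtain ⟨B₃, hB₃⟩ := exists_im_bound_of_eventually (heq.filter_mono nhdsWithin_le_nhds)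
  refine ⟨p, m₁, m₂, κ, max (max B₁ B₂) B₃, hpΛ, hm.symm, hX, hκ0, fun τ hτ => ?_⟩
  have h12 : max B₁ B₂ < τ.im := (le_max_left _ _).trans_lt hτ
  have h1 : B₁ < τ.im := (le_max_left _ _).trans_lt h12
  have h2 : B₂ < τ.im := (le_max_right _ _).trans_lt h12
  have h3 : B₃ < τ.im := (le_max_right _ _).trans_lt hτ
  obtain ⟨hwΛ, hP₃w⟩ := hB₂ τ h2
  rw [qGerm_apply] at hwΛ hP₃w
  have hsum := (hR τ h1).1
  rw [← hB₃ τ h3, hΨτ τ, ← hΦeq τ hwΛ hP₃w] at hsum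
  exact hsum

/-! ### §4 The `Γ₀(N)`-multiplier of `G₂ = t_s·V_a(c·E_f)` -/

/-- **`G₂(γτ) = ρ_γ·G₂(τ)`** with `ρ_γ ≠ 0` the multiplier of `V_a` along `μ_γ = c·{∞,γ∞}_f ∈ Λ` (p2 g16's `sigmaSqRoot_add_of_mem_lattice`). [folklore] -/
theorem exists_sqMultiplier_gamma (D : ModularParametrizationData W N) (p e : ℂ) (γ : Gamma0 N) :
    ∃ ρ : ℂ, ρ ≠ 0 ∧ (∀ w : ℂ, sigmaSqRoot D.L p e (w + (D.c : ℂ) * cuspSymbol D.f γ) = ρ * sigmaSqRoot D.L p e w) ∧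
      ∀ τ : UpperHalfPlane,
        shortT D ((γ : SL(2, ℤ)) • τ) * sigmaSqRoot D.L p e ((D.c : ℂ) * eichlerIntegral D.f ((γ : SL(2, ℤ)) • τ)) =
          ρ * (shortT D τ * sigmaSqRoot D.L p e ((D.c : ℂ) * eichlerIntegral D.f τ)) := by
  obtain ⟨ρ, hρ0, hρ⟩ := sigmaSqRoot_add_of_mem_lattice D.L p e (smul_cuspSymbol_mem_lattice D γ)
  refine ⟨ρ, hρ0, hρ, fun τ => ?_⟩
  rw [shortT_gamma_smul, smul_eichlerIntegral_gamma_smul, hρ]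
  ring

/-- `G₂ ≢ 0`. [folklore] -/
theorem exists_shortT_mul_sigmaSqRoot_ne_zero [W.IsElliptic] (D : ModularParametrizationData W N) (hc0 : D.c ≠ 0) {p : ℂ}
    (hp : p ∉ D.L.lattice) (e : ℂ) : ∃ τ : UpperHalfPlane, shortT D τ * sigmaSqRoot D.L p e ((D.c : ℂ) * eichlerIntegral D.f τ) ≠ 0 := by
  obtain ⟨Φ, P₃, hΦan, hΦ0, hP₃d, hP₃0, hΦeq⟩ := exists_analytic_shortT_mul_sigmaSqRoot D hc0 hp e
  have hf1 : cuspCoeff D.f 1 = 1 := by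
    rw [D.isNewformOf.2 1, W.isMultiplicative_LFunction.map_one]; simp
  have hc : (D.c : ℂ) ≠ 0 := Int.cast_ne_zero.mpr hc0
  have hP : ContinuousAt (fun w => Φ w * P₃ w) 0 := hΦan.continuousAt.mul hP₃d.continuous.continuousAt
  have hP0 : Φ 0 * P₃ 0 ≠ 0 := mul_ne_zero hΦ0 (by rw [hP₃0]; norm_num)
  have hev := eventually_smul_qGerm_notMem D.f hf1 D.L hc hP hP0
  obtain ⟨B, hB⟩ := exists_im_bound_of_eventually hev
  obtain ⟨τ, hτ⟩ := exists_im_gt B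
  obtain ⟨hwΛ, hne⟩ := hB τ hτ
  rw [qGerm_apply] at hwΛ hne
  refine ⟨τ, ?_⟩
  rw [hΦeq τ hwΛ (right_ne_zero_of_mul hne)]
  exact left_ne_zero_of_mul hne

/-- **The stabiliser of `G₂` in `Γ₀(N)` is the kernel of the `ℓ = 2` Kummer character**: `(∀ τ, G₂(γτ) = G₂ τ) ⟺ V_a` is periodic under
`c·{∞,γ∞}_f`. [folklore] -/
theorem forall_gamma_smul_eq_iff_sigmaSqRoot_periodic [W.IsElliptic] (D : ModularParametrizationData W N) (hc0 : D.c ≠ 0)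
    {p : ℂ} (hp : p ∉ D.L.lattice) (e : ℂ) (γ : Gamma0 N) :
    (∀ τ : UpperHalfPlane,
      shortT D ((γ : SL(2, ℤ)) • τ) * sigmaSqRoot D.L p e ((D.c : ℂ) * eichlerIntegral D.f ((γ : SL(2, ℤ)) • τ)) =
        shortT D τ * sigmaSqRoot D.L p e ((D.c : ℂ) * eichlerIntegral D.f τ)) ↔
      ∀ w : ℂ, sigmaSqRoot D.L p e (w + (D.c : ℂ) * cuspSymbol D.f γ) = sigmaSqRoot D.L p e w := by
  obtain ⟨ρ, -, hρW, hρG⟩ := exists_sqMultiplier_gamma D p e γ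
  constructor
  · intro hG w
    obtain ⟨τ₀, hτ₀⟩ := exists_shortT_mul_sigmaSqRoot_ne_zero D hc0 hp e
    have hρ1 : ρ = 1 := by
      have h := hρG τ₀
      rw [hG τ₀] at h
      exact mul_right_cancel₀ hτ₀ (h.symm.trans (one_mul _).symm)
    rw [hρW w, hρ1, one_mul]
  · intro hper τ
    rw [shortT_gamma_smul, smul_eichlerIntegral_gamma_smul, hper]

end Summit.BirchSwinnertonDyer.BirchSwinnertonDyer.Theorems.ManinLocalTwoThree.KummerSquareRootDictionary

end
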